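import Mathlib
import Literature.Probability.Process.RootedHardCoreConfig
import Literature.Probability.Process.PointStationaryLaw
import Literature.MathematicalPhysics.StatisticalMechanics.BarlowStacking
import Literature.MathematicalPhysics.StatisticalMechanics.HaggStacking
import Summits.AtomisticToContinuum.Crystallization.Theorems.ChartedPlanarOrderDefectEventGeometry

/-!
# Null-measurability of the strict planar-defect event (lens-3 g12, residual `R`, part 2)

decomp-a2c · lens-3 · generation 12 · crux `ChartedPlanarOrder.ChartedZeroExcessLayered` (stmt-AtomisticToContinuum-26636),
registered skeleton `ChartedZeroExcessLayered_window_birth.lean` (sha256 660351068daaba86).  PROVES the residual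
`R` «DefectEventNullMeasurable» of the WindowDuality node (HOME decomp-a2c-lens-3/g12/sigs12.json["R"], verbatim): under every
law giving full measure to rooted `δ`-separated counting measures, the strict defect event at the root (no flexible-gap
layered Barlow pattern of scale `b ∈ [9/10, 1]` strictly `η`-matches the configuration in the `4b`/`5b` balls) is
`P`-null-measurable.  Descriptive-set-theoretic bookkeeping made finite: for FIXED parameters the matching event is Borel on
counting measures (`Bset`, `match_iff_Bset`); on SEPARATED counting measures its parameter sections are open
(`exists_open_nbhd`: finitely many atoms in the `5`-ball, a norm gap above `4b`, the frozen Hägg window, the index box);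
the admissible parameters have a countable net (`exists_countable_net`); so the event agrees a.e. with a countable union
of Borel sets (`defectEventNullMeasurable`).  Used by `ChartedPlanarOrderEnvelopeTransport.lean` to make the walk-transport
stub `stub_walkTransportEnvS` unconditional.  No new Prop definitions; axioms standard.
-/

set_option maxHeartbeats 800000

namespace Summit.AtomisticToContinuum.Crystallization.Theorems.ChartedPlanarOrderDefectEventMeasurable

open MeasureTheory Metric Literature.MathematicalPhysics.StatisticalMechanics
open Summit.AtomisticToContinuum.Crystallization.Theorems.ChartedPlanarOrderDefectEventGeometry

/-! ## The Borel candidate `Bset` and its identification on counting measures -/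

/-- the set `closed ball ∖ ⋃ₖ open balls` is Borel. -/
theorem measurableSet_patUnion (r η : ℝ) (p : ℤ × ℤ × ℤ → EuclideanSpace ℝ (Fin 3)) :
    MeasurableSet (closedBall (0 : EuclideanSpace ℝ (Fin 3)) r \ ⋃ k, ball (p k) η) :=
  measurableSet_closedBall.diff (MeasurableSet.iUnion fun _ => measurableSet_ball)

/-- `Bset b η p` is a Borel set of measures (evaluation maps are measurable, `Measure.measurable_coe`). -/
theorem measurableSet_Bset (b η : ℝ) (p : ℤ × ℤ × ℤ → EuclideanSpace ℝ (Fin 3)) : MeasurableSet (Bset b η p) := by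
  have h1 : MeasurableSet {μ : Measure (EuclideanSpace ℝ (Fin 3)) | μ (closedBall 0 (4 * b) \ ⋃ k, ball (p k) η) = 0} :=
    (Measure.measurable_coe (measurableSet_patUnion _ η p)) (measurableSet_singleton 0)
  have h2 : ∀ k, MeasurableSet {μ : Measure (EuclideanSpace ℝ (Fin 3)) | ‖p k‖ ≤ 5 * b → μ (ball (p k) η) ≠ 0} := by
    intro k
    by_cases hk : ‖p k‖ ≤ 5 * b
    · have : {μ : Measure (EuclideanSpace ℝ (Fin 3)) | ‖p k‖ ≤ 5 * b → μ (ball (p k) η) ≠ 0} =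
          {μ : Measure (EuclideanSpace ℝ (Fin 3)) | μ (ball (p k) η) ≠ 0} := by
        ext μ; simp only [Set.mem_setOf_eq]; exact ⟨fun h => h hk, fun h _ => h⟩
      rw [this]
      exact ((Measure.measurable_coe measurableSet_ball) (measurableSet_singleton 0)).compl
    · have : {μ : Measure (EuclideanSpace ℝ (Fin 3)) | ‖p k‖ ≤ 5 * b → μ (ball (p k) η) ≠ 0} = Set.univ := by
        ext μ; simp only [Set.mem_setOf_eq, Set.mem_univ, iff_true]; exact fun h => absurd h hk
      rw [this]; exact MeasurableSet.univ
  have : Bset b η p = {μ | μ (closedBall 0 (4 * b) \ ⋃ k, ball (p k) η) = 0} ∩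
      ⋂ k, {μ | ‖p k‖ ≤ 5 * b → μ (ball (p k) η) ≠ 0} := by
    ext μ; simp only [Bset, Set.mem_setOf_eq, Set.mem_inter_iff, Set.mem_iInter]
  rw [this]
  exact h1.inter (MeasurableSet.iInter h2)

/-- on a counting measure `count|S` the two strict matching clauses of the defect event are EXACTLY membership
in `Bset` (no separation needed) -/
theorem match_iff_Bset (S : Set (EuclideanSpace ℝ (Fin 3))) (b η : ℝ) (A : EuclideanSpace ℝ (Fin 3) →ₗᵢ[ℝ] EuclideanSpace ℝ (Fin 3)) (s : ℤ → ℤ) (z : ℤ → ℝ) :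
    ((∀ y : EuclideanSpace ℝ (Fin 3), dist y (0 : EuclideanSpace ℝ (Fin 3)) ≤ 4 * b →
        (Measure.count : Measure (EuclideanSpace ℝ (Fin 3))).restrict S {y} ≠ 0 →
        ∃ y' : EuclideanSpace ℝ (Fin 3), y' - (0 : EuclideanSpace ℝ (Fin 3)) ∈ {p | ∃ m i j : ℤ, p = A (((i : ℝ) • triangularVec₁ b) + ((j : ℝ) • triangularVec₂ b) + ((haggLabel s m : ℝ) • barlowOffset b) + (z m • layerNormal 1))} ∧ dist y y' < η) ∧
     (∀ y' : EuclideanSpace ℝ (Fin 3), y' - (0 : EuclideanSpace ℝ (Fin 3)) ∈ {p | ∃ m i j : ℤ, p = A (((i : ℝ) • triangularVec₁ b) + ((j : ℝ) • triangularVec₂ b) + ((haggLabel s m : ℝ) • barlowOffset b) + (z m • layerNormal 1))} → dist y' (0 : EuclideanSpace ℝ (Fin 3)) ≤ 5 * b →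
        ∃ y : EuclideanSpace ℝ (Fin 3), (Measure.count : Measure (EuclideanSpace ℝ (Fin 3))).restrict S {y} ≠ 0 ∧ dist y y' < η))
    ↔ (Measure.count : Measure (EuclideanSpace ℝ (Fin 3))).restrict S ∈
        Bset b η (fun k => A (patVec b (haggLabel s k.1) (z k.1) k.2.1 k.2.2)) := by
  have hsing := Literature.Probability.Process.count_restrict_singleton_ne_zero_iff (E := EuclideanSpace ℝ (Fin 3)) S
  constructor
  · rintro ⟨h1, h2⟩
    refine ⟨?_, ?_⟩
    · rw [Measure.restrict_apply (measurableSet_patUnion _ η _), Measure.count_eq_zero_iff,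
        ← Set.not_nonempty_iff_eq_empty]
      rintro ⟨y, ⟨hyB, hyU⟩, hyS⟩
      obtain ⟨y', hy', hd⟩ := h1 y (mem_closedBall.mp hyB) ((hsing y).mpr hyS)
      rw [sub_zero] at hy'
      obtain ⟨m, i, j, rfl⟩ := hy'
      exact hyU (Set.mem_iUnion.mpr ⟨(m, i, j), mem_ball.mpr hd⟩)
    · intro k hk h0
      rw [Measure.restrict_apply measurableSet_ball, Measure.count_eq_zero_iff] at h0
      have hk' : dist (A (patVec b (haggLabel s k.1) (z k.1) k.2.1 k.2.2)) (0 : EuclideanSpace ℝ (Fin 3)) ≤ 5 * b := by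
        rwa [dist_zero_right]
      obtain ⟨y, hy, hd⟩ := h2 (A (patVec b (haggLabel s k.1) (z k.1) k.2.1 k.2.2))
        (by rw [sub_zero]; exact ⟨k.1, k.2.1, k.2.2, rfl⟩) hk'
      have hyS := (hsing y).mp hy
      have : y ∈ ball (A (patVec b (haggLabel s k.1) (z k.1) k.2.1 k.2.2)) η ∩ S := ⟨mem_ball.mpr hd, hyS⟩
      rw [h0] at this
      simp at this
  · rintro ⟨h1, h2⟩
    refine ⟨?_, ?_⟩
    · intro y hyd hyμ
      have hyS := (hsing y).mp hyμ
      rw [Measure.restrict_apply (measurableSet_patUnion _ η _), Measure.count_eq_zero_iff,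
        ← Set.not_nonempty_iff_eq_empty] at h1
      have hyU : y ∈ ⋃ k : ℤ × ℤ × ℤ, ball (A (patVec b (haggLabel s k.1) (z k.1) k.2.1 k.2.2)) η := by
        by_contra hyU
        exact h1 ⟨y, ⟨mem_closedBall.mpr hyd, hyU⟩, hyS⟩
      obtain ⟨k, hk⟩ := Set.mem_iUnion.mp hyU
      exact ⟨_, by rw [sub_zero]; exact ⟨k.1, k.2.1, k.2.2, rfl⟩, mem_ball.mp hk⟩
    · intro y' hy' hd'
      rw [sub_zero] at hy'
      obtain ⟨m, i, j, rfl⟩ := hy'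
      have hne := h2 (m, i, j) (by rw [dist_zero_right] at hd'; exact hd')
      rw [Measure.restrict_apply measurableSet_ball] at hne
      have hne' : (ball (A (patVec b (haggLabel s m) (z m) i j)) η ∩ S).Nonempty := by
        by_contra h
        rw [Set.not_nonempty_iff_eq_empty] at h
        exact hne (by rw [h, measure_empty])
      obtain ⟨y, hyb, hyS⟩ := hne'
      exact ⟨y, (hsing y).mpr hyS, mem_ball.mp hyb⟩

/-! ## A countable net of admissible parameters -/

/-- the admissible parameter set has a countable net: a countable subset meeting every relatively open neighbourhood (second countability of `ℝ × (E →L E) × (ℤ → ℤ) × (ℤ → ℝ)`). -/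
theorem exists_countable_net : ∃ D : Set Param, D.Countable ∧ D ⊆ piSet ∧
    ∀ π₀ ∈ piSet, ∀ V : Set Param, IsOpen V → π₀ ∈ V → ∃ q ∈ D, q ∈ V := by
  obtain ⟨c, hc, hd⟩ := TopologicalSpace.exists_countable_dense (piSet : Set Param)
  refine ⟨Subtype.val '' c, hc.image _, ?_, ?_⟩
  · rintro _ ⟨x, _, rfl⟩; exact x.2
  · intro π₀ hπ₀ V hV hπV
    have hU : IsOpen (Subtype.val ⁻¹' V : Set piSet) := hV.preimage continuous_subtype_val
    obtain ⟨x, hxV, hxc⟩ := hd.inter_open_nonempty _ hU ⟨⟨π₀, hπ₀⟩, hπV⟩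
    exact ⟨x.1, ⟨x, hxc, rfl⟩, hxV⟩

/-! ## Openness of the matching sections on a separated counting measure -/

/-- finitely many atoms in the `5`-ball leave a norm gap above any level `r ≤ 4`: atoms of norm `≤ r + ε` have norm `≤ r`. -/
theorem exists_norm_gap {S : Set (EuclideanSpace ℝ (Fin 3))} (hF : (closedBall (0 : EuclideanSpace ℝ (Fin 3)) 5 ∩ S).Finite) {r : ℝ} (hr : r ≤ 4) :
    ∃ ε : ℝ, 0 < ε ∧ ε ≤ 1 ∧ ∀ y ∈ S, ‖y‖ ≤ r + ε → ‖y‖ ≤ r := by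
  classical
  set T := hF.toFinset.filter (fun y => r < ‖y‖) with hT
  have hmemT : ∀ y ∈ S, ‖y‖ ≤ r + 1 → r < ‖y‖ → y ∈ T := by
    intro y hyS hy1 hyr
    rw [hT, Finset.mem_filter, Set.Finite.mem_toFinset]
    exact ⟨⟨mem_closedBall_zero_iff.mpr (by linarith), hyS⟩, hyr⟩
  rcases T.eq_empty_or_nonempty with hTe | hTn
  · refine ⟨1, one_pos, le_rfl, fun y hyS hy1 => ?_⟩
    by_contra hyr
    have := hmemT y hyS hy1 (lt_of_not_ge hyr)
    rw [hTe] at this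
    simp at this
  · obtain ⟨y₀, hy₀T, hmin⟩ := T.exists_min_image (fun y => ‖y‖) hTn
    have hy₀r : r < ‖y₀‖ := by
      rw [hT, Finset.mem_filter] at hy₀T; exact hy₀T.2
    refine ⟨min 1 ((‖y₀‖ - r) / 2), lt_min one_pos (by linarith), min_le_left _ _, fun y hyS hy1 => ?_⟩
    by_contra hyr
    have hyT := hmemT y hyS (hy1.trans (by linarith [min_le_left (1:ℝ) ((‖y₀‖ - r) / 2)])) (lt_of_not_ge hyr)
    have h1 := hmin y hyT
    have h2 : ‖y‖ ≤ r + (‖y₀‖ - r) / 2 := hy1.trans (by linarith [min_le_right (1:ℝ) ((‖y₀‖ - r) / 2)])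
    linarith

/-- OPENNESS of the matching sections: on a `δ`-separated counting measure, every admissible parameter close enough to a matching one (scale, frame, heights close; Hägg word equal on a finite window) matches as well. -/
theorem exists_open_nbhd {δ : ℝ} (hδ : 0 < δ) {S : Set (EuclideanSpace ℝ (Fin 3))}
    (hsep : ∀ x ∈ S, ∀ y ∈ S, x ≠ y → δ ≤ dist x y) {η : ℝ} {π₀ : Param} (hπ₀ : π₀ ∈ piSet)
    (hB : (Measure.count : Measure (EuclideanSpace ℝ (Fin 3))).restrict S ∈ Bset π₀.1 η (pt π₀)) :
    ∃ V : Set Param, IsOpen V ∧ π₀ ∈ V ∧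
      ∀ π ∈ V, π ∈ piSet → (Measure.count : Measure (EuclideanSpace ℝ (Fin 3))).restrict S ∈ Bset π.1 η (pt π) := by
  classical
  obtain ⟨hb0, hb01, hA0, hs0, hgap0, hz00⟩ := hπ₀
  have hsing := Literature.Probability.Process.count_restrict_singleton_ne_zero_iff (E := EuclideanSpace ℝ (Fin 3)) S
  obtain ⟨hB1, hB2⟩ := hB
  -- atom-level reading of `hB`
  have hat1 : ∀ y ∈ S, ‖y‖ ≤ 4 * π₀.1 → ∃ k : ℤ × ℤ × ℤ, dist y (pt π₀ k) < η := by
    intro y hyS hy4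
    rw [Measure.restrict_apply (measurableSet_patUnion _ η _), Measure.count_eq_zero_iff,
      ← Set.not_nonempty_iff_eq_empty] at hB1
    by_contra hk
    push Not at hk
    refine hB1 ⟨y, ⟨mem_closedBall_zero_iff.mpr hy4, ?_⟩, hyS⟩
    intro hyU
    obtain ⟨k, hk'⟩ := Set.mem_iUnion.mp hyU
    exact (not_lt.mpr (hk k)) (mem_ball.mp hk')
  have hat2 : ∀ k : ℤ × ℤ × ℤ, ‖pt π₀ k‖ ≤ 5 * π₀.1 → ∃ y ∈ S, dist y (pt π₀ k) < η := by
    intro k hk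
    have hne := hB2 k hk
    rw [Measure.restrict_apply measurableSet_ball] at hne
    have hne' : (ball (pt π₀ k) η ∩ S).Nonempty := by
      by_contra h
      rw [Set.not_nonempty_iff_eq_empty] at h
      exact hne (by rw [h, measure_empty])
    obtain ⟨y, hyb, hyS⟩ := hne'
    exact ⟨y, hyS, mem_ball.mp hyb⟩
  choose! kf hkf using hat1
  choose! yf hyfS hyf using hat2
  -- finitely many atoms in the `5`-ball; the norm gap above `4 b₀`; the label window `Mw`
  have hF : (closedBall (0 : EuclideanSpace ℝ (Fin 3)) 5 ∩ S).Finite :=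
    Literature.Probability.Process.LocalConfig.finite_inter_of_separated hδ hsep (isCompact_closedBall 0 5)
  obtain ⟨ε, hε, hε1, hgapN⟩ := exists_norm_gap hF (r := 4 * π₀.1) (by linarith)
  set F₁ : Set (EuclideanSpace ℝ (Fin 3)) := {y | y ∈ closedBall (0 : EuclideanSpace ℝ (Fin 3)) 5 ∩ S ∧ ‖y‖ ≤ 4 * π₀.1} with hF₁
  have hF₁fin : F₁.Finite := hF.subset (fun y hy => hy.1)
  set Mw : ℕ := 7 + ∑ y ∈ hF₁fin.toFinset, (kf y).1.natAbs with hMw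
  have hMw7 : (7 : ℤ) ≤ (Mw : ℤ) := by
    have : 7 ≤ Mw := by rw [hMw]; exact Nat.le_add_right 7 _
    exact_mod_cast this
  have hMwy : ∀ y ∈ F₁, |(kf y).1| ≤ (Mw : ℤ) := by
    intro y hy
    have hmem : y ∈ hF₁fin.toFinset := hF₁fin.mem_toFinset.mpr hy
    have h1 : (kf y).1.natAbs ≤ ∑ y ∈ hF₁fin.toFinset, (kf y).1.natAbs :=
      Finset.single_le_sum (f := fun y => (kf y).1.natAbs) (fun _ _ => Nat.zero_le _) hmem
    have h2 : (kf y).1.natAbs ≤ Mw := by rw [hMw]; exact le_add_left h1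
    rw [Int.abs_eq_natAbs]; exact_mod_cast h2
  -- the index box, the frozen word, the open pieces
  set Kbox : Finset (ℤ × ℤ × ℤ) :=
    Finset.Icc (-7 : ℤ) 7 ×ˢ (Finset.Icc (-13 : ℤ) 13 ×ˢ Finset.Icc (-8 : ℤ) 8) with hKbox
  set s₀ : ℤ → ℤ := π₀.2.2.1 with hs₀
  set W : ℤ × ℤ × ℤ → Set Param := fun k =>
    if ‖pt π₀ k‖ ≤ 5 * π₀.1 then {π | dist (yf k) (ptL s₀ k π) < η} else {π | 5 * π.1 < ‖ptL s₀ k π‖}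
    with hW
  set V : Set Param :=
    ({π : Param | π.1 < π₀.1 + ε / 4} ∩ ⋂ i ∈ Finset.Icc (-(Mw : ℤ)) Mw, {π : Param | π.2.2.1 i = s₀ i}) ∩
    ((⋂ y ∈ F₁, {π : Param | dist y (ptL s₀ (kf y) π) < η}) ∩ ⋂ k ∈ Kbox, W k) with hV
  have hWdef : ∀ k, W k = if ‖pt π₀ k‖ ≤ 5 * π₀.1 then {π | dist (yf k) (ptL s₀ k π) < η}
      else {π | 5 * π.1 < ‖ptL s₀ k π‖} := fun k => rfl
  refine ⟨V, ?_, ?_, ?_⟩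
  · -- `V` is open
    rw [hV]
    refine ((isOpen_lt continuous_fst continuous_const).inter (isOpen_biInter_finset fun i _ => ?_)).inter
      ((hF₁fin.isOpen_biInter fun y _ =>
        isOpen_lt (continuous_const.dist (continuous_ptL s₀ _)) continuous_const).inter
        (isOpen_biInter_finset fun k _ => ?_))
    · have hci : Continuous fun π : Param => π.2.2.1 i :=
        (continuous_apply i).comp (continuous_fst.comp (continuous_snd.comp continuous_snd))
      exact (isOpen_discrete ({s₀ i} : Set ℤ)).preimage hci
    · rw [hWdef k]
      split_ifs
      · exact isOpen_lt (continuous_const.dist (continuous_ptL s₀ k)) continuous_const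
      · exact isOpen_lt (continuous_const.mul continuous_fst) (continuous_ptL s₀ k).norm
  · -- `π₀ ∈ V`
    rw [hV]
    refine ⟨⟨?_, ?_⟩, ⟨?_, ?_⟩⟩
    · show π₀.1 < π₀.1 + ε / 4
      linarith
    · simp only [Set.mem_iInter, Set.mem_setOf_eq]
      intro i _
      rfl
    · simp only [Set.mem_iInter, Set.mem_setOf_eq]
      intro y hy
      exact hkf y hy.1.2 hy.2
    · simp only [Set.mem_iInter]
      intro k _
      rw [hWdef k]
      split_ifs with hk
      · exact hyf k hk
      · show 5 * π₀.1 < ‖pt π₀ k‖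
        exact lt_of_not_ge hk
  · -- every admissible parameter in `V` matches
    intro π hπV hπ
    obtain ⟨hb, hb1, hA, hs, hgap, hz0⟩ := hπ
    rw [hV] at hπV
    obtain ⟨⟨hπb, hπs⟩, hπO, hπW⟩ := hπV
    replace hπb : π.1 < π₀.1 + ε / 4 := hπb
    simp only [Set.mem_iInter, Set.mem_setOf_eq] at hπs hπO
    simp only [Set.mem_iInter] at hπW
    have hagree : ∀ i : ℤ, |i| ≤ (Mw : ℤ) → π.2.2.1 i = s₀ i := fun i hi =>
      hπs i (Finset.mem_Icc.mpr (abs_le.mp hi))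
    refine ⟨?_, ?_⟩
    · -- clause (1): every atom of norm `≤ 4 b` is `η`-close to the pattern
      rw [Measure.restrict_apply (measurableSet_patUnion _ η _), Measure.count_eq_zero_iff,
        ← Set.not_nonempty_iff_eq_empty]
      rintro ⟨y, ⟨hyB, hyU⟩, hyS⟩
      have hy4 : ‖y‖ ≤ 4 * π.1 := mem_closedBall_zero_iff.mp hyB
      have hy40 : ‖y‖ ≤ 4 * π₀.1 := hgapN y hyS (by linarith)
      have hyF₁ : y ∈ F₁ := ⟨⟨mem_closedBall_zero_iff.mpr (by linarith), hyS⟩, hy40⟩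
      have hd := hπO y hyF₁
      rw [← pt_eq_ptL hagree (hMwy y hyF₁)] at hd
      exact hyU (Set.mem_iUnion.mpr ⟨kf y, mem_ball.mpr hd⟩)
    · -- clause (2): every pattern point of norm `≤ 5 b` has an atom `η`-close
      intro k hk
      have hk5 : ‖π.2.1 (patVec π.1 (haggLabel π.2.2.1 k.1) (π.2.2.2 k.1) k.2.1 k.2.2)‖ ≤ 5 := by
        have : ‖pt π k‖ ≤ 5 := hk.trans (by linarith)
        exact this
      obtain ⟨hm7, hj8, hi13⟩ := index_box hb hs (fun m => (hgap m).1) hz0 π.2.1 hA hk5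
      have hkK : k ∈ Kbox := by
        rw [hKbox]
        exact Finset.mem_product.mpr ⟨Finset.mem_Icc.mpr (abs_le.mp hm7),
          Finset.mem_product.mpr ⟨Finset.mem_Icc.mpr (abs_le.mp hi13), Finset.mem_Icc.mpr (abs_le.mp hj8)⟩⟩
      have hWk := hπW k hkK
      have hptL : pt π k = ptL s₀ k π := pt_eq_ptL hagree (hm7.trans hMw7)
      rw [hWdef k] at hWk
      by_cases hk0 : ‖pt π₀ k‖ ≤ 5 * π₀.1
      · rw [if_pos hk0] at hWk
        have hd : dist (yf k) (pt π k) < η := by rw [hptL]; exact hWk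
        intro h0
        rw [Measure.restrict_apply measurableSet_ball, Measure.count_eq_zero_iff] at h0
        have : yf k ∈ ball (pt π k) η ∩ S := ⟨mem_ball.mpr hd, hyfS k hk0⟩
        rw [h0] at this
        simp at this
      · rw [if_neg hk0] at hWk
        have hlt : 5 * π.1 < ‖pt π k‖ := by rw [hptL]; exact hWk
        exact absurd hk (not_le.mpr hlt)

/-! ## The residual `R`: null-measurability of the strict defect event -/

/-- LENS-3 g12 RESIDUAL `R` («DefectEventNullMeasurable», verbatim `sigs12.json["R"]` of the registered skeleton
`ChartedZeroExcessLayered_window_birth.lean` 660351068daaba86): under every law giving full measure to rooted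
`δ`-separated counting measures, the strict planar-defect event (the complement of the strict flexible-gap layered
matching event at the root) is `P`-null-measurable, for every tolerance `η > 0`.  Proof: on counting measures the
matching event with FIXED parameters is Borel (`match_iff_Bset`, `measurableSet_Bset`); its parameter sections are
open on separated configurations (`exists_open_nbhd`: finitely many atoms in the `5`-ball, the index box, a norm
gap above `4 b`); the admissible parameter set has a countable net (`exists_countable_net`, second countability);
hence the event agrees `P`-a.e. with a countable union of Borel sets. -/
theorem defectEventNullMeasurable : ∀ δ : ℝ, 0 < δ → ∀ P : MeasureTheory.Measure (MeasureTheory.Measure (EuclideanSpace ℝ (Fin 3))), (∀ᵐ μ ∂P, (∃ S : Set (EuclideanSpace ℝ (Fin 3)), (0 : EuclideanSpace ℝ (Fin 3)) ∈ S ∧ (∀ x ∈ S, ∀ y ∈ S, x ≠ y → δ ≤ dist x y) ∧ μ = (MeasureTheory.Measure.count : MeasureTheory.Measure (EuclideanSpace ℝ (Fin 3))).restrict S)) → ∀ η : ℝ, 0 < η → MeasureTheory.NullMeasurableSet {μ : MeasureTheory.Measure (EuclideanSpace ℝ (Fin 3)) | ¬ (∃ b : ℝ, 9 / 10 ≤ b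 ∧ b ≤ 1 ∧ ∃ (A : EuclideanSpace ℝ (Fin 3) →ₗᵢ[ℝ] EuclideanSpace ℝ (Fin 3)) (s : ℤ → ℤ) (z : ℤ → ℝ), Literature.MathematicalPhysics.StatisticalMechanics.IsHaggSeq s ∧ (∀ m : ℤ, 39 / 50 * b ≤ z (m + 1) - z m ∧ z (m + 1) - z m ≤ 17 / 20 * b) ∧ z 0 = 0 ∧ (∀ y : EuclideanSpace ℝ (Fin 3), dist y (0 : EuclideanSpace ℝ (Fin 3)) ≤ 4 * b → μ {y} ≠ 0 → ∃ y' : EuclideanSpace ℝ (Fin 3), y' - (0 : EuclideanSpace ℝ (Fin 3)) ∈ {p | ∃ m i j : ℤ, p = A (((i : ℝ) • Literature.MathematicalPhysics.StatisticalMechanics.triangularVec₁ b) + ((j : ℝ) • Literature.MathematicalPhysics.StatisticalMechanics.triangularVec₂ b) + ((Literature.MathematicalPhysics.StatisticalMechanics.haggLabel s m : ℝ) • Literature.MathematicalPhysics.StatisticalMechanics.barlowOffset b) + (z m • Literature.MathematicalPhysics.StatisticalMechanics.layerNormal 1))} ∧ dist y y' < η) ∧ (∀ y' : EuclideanSpace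 ℝ (Fin 3), y' - (0 : EuclideanSpace ℝ (Fin 3)) ∈ {p | ∃ m i j : ℤ, p = A (((i : ℝ) • Literature.MathematicalPhysics.StatisticalMechanics.triangularVec₁ b) + ((j : ℝ) • Literature.MathematicalPhysics.StatisticalMechanics.triangularVec₂ b) + ((Literature.MathematicalPhysics.StatisticalMechanics.haggLabel s m : ℝ) • Literature.MathematicalPhysics.StatisticalMechanics.barlowOffset b) + (z m • Literature.MathematicalPhysics.StatisticalMechanics.layerNormal 1))} → dist y' (0 : EuclideanSpace ℝ (Fin 3)) ≤ 5 * b → ∃ y : EuclideanSpace ℝ (Fin 3), μ {y} ≠ 0 ∧ dist y y' < η))} P := by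
  intro δ hδ P hroot η hη
  obtain ⟨D, hDc, hDsub, hDnet⟩ := exists_countable_net
  have hM : MeasurableSet (⋃ q ∈ D, Bset q.1 η (pt q)) :=
    MeasurableSet.biUnion hDc (fun q _ => measurableSet_Bset _ _ _)
  -- on a separated counting measure, the strict matching event is membership in the countable union
  have key : ∀ S : Set (EuclideanSpace ℝ (Fin 3)), (∀ x ∈ S, ∀ y ∈ S, x ≠ y → δ ≤ dist x y) →
      ((∃ b : ℝ, 9 / 10 ≤ b ∧ b ≤ 1 ∧ ∃ (A : EuclideanSpace ℝ (Fin 3) →ₗᵢ[ℝ] EuclideanSpace ℝ (Fin 3)) (s : ℤ → ℤ) (z : ℤ → ℝ),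
        IsHaggSeq s ∧ (∀ m : ℤ, 39 / 50 * b ≤ z (m + 1) - z m ∧ z (m + 1) - z m ≤ 17 / 20 * b) ∧ z 0 = 0 ∧
        (∀ y : EuclideanSpace ℝ (Fin 3), dist y (0 : EuclideanSpace ℝ (Fin 3)) ≤ 4 * b →
          (Measure.count : Measure (EuclideanSpace ℝ (Fin 3))).restrict S {y} ≠ 0 →
          ∃ y' : EuclideanSpace ℝ (Fin 3), y' - (0 : EuclideanSpace ℝ (Fin 3)) ∈ {p | ∃ m i j : ℤ, p = A (((i : ℝ) • triangularVec₁ b) + ((j : ℝ) • triangularVec₂ b) + ((haggLabel s m : ℝ) • barlowOffset b) + (z m • layerNormal 1))} ∧ dist y y' < η) ∧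
        (∀ y' : EuclideanSpace ℝ (Fin 3), y' - (0 : EuclideanSpace ℝ (Fin 3)) ∈ {p | ∃ m i j : ℤ, p = A (((i : ℝ) • triangularVec₁ b) + ((j : ℝ) • triangularVec₂ b) + ((haggLabel s m : ℝ) • barlowOffset b) + (z m • layerNormal 1))} → dist y' (0 : EuclideanSpace ℝ (Fin 3)) ≤ 5 * b →
          ∃ y : EuclideanSpace ℝ (Fin 3), (Measure.count : Measure (EuclideanSpace ℝ (Fin 3))).restrict S {y} ≠ 0 ∧ dist y y' < η)) ↔
      (Measure.count : Measure (EuclideanSpace ℝ (Fin 3))).restrict S ∈ ⋃ q ∈ D, Bset q.1 η (pt q)) := by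
    intro S hsepS
    constructor
    · rintro ⟨b, hb, hb1, A, s, z, hs, hgap, hz0, h1, h2⟩
      set π₀ : Param := (b, (A.toContinuousLinearMap, (s, z))) with hπ₀def
      have hπ₀ : π₀ ∈ piSet := ⟨hb, hb1, fun v => A.norm_map v, hs, hgap, hz0⟩
      have hB : (Measure.count : Measure (EuclideanSpace ℝ (Fin 3))).restrict S ∈ Bset π₀.1 η (pt π₀) := by
        have := (match_iff_Bset S b η A s z).mp ⟨h1, h2⟩
        exact this
      obtain ⟨V, hVo, hπV, hV⟩ := exists_open_nbhd hδ hsepS hπ₀ hB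
      obtain ⟨q, hqD, hqV⟩ := hDnet π₀ hπ₀ V hVo hπV
      exact Set.mem_biUnion hqD (hV q hqV (hDsub hqD))
    · intro hmem
      obtain ⟨q, hqD, hq⟩ := Set.mem_iUnion₂.mp hmem
      obtain ⟨hb, hb1, hA, hs, hgap, hz0⟩ := hDsub hqD
      let A' : EuclideanSpace ℝ (Fin 3) →ₗᵢ[ℝ] EuclideanSpace ℝ (Fin 3) := ⟨q.2.1.toLinearMap, hA⟩
      have hm := (match_iff_Bset S q.1 η A' q.2.2.1 q.2.2.2).mpr hq
      exact ⟨q.1, hb, hb1, A', q.2.2.1, q.2.2.2, hs, hgap, hz0, hm.1, hm.2⟩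
  refine (hM.compl.nullMeasurableSet).congr ?_
  filter_upwards [hroot] with μ hμ
  obtain ⟨S, -, hsepS, rfl⟩ := hμ
  have := key S hsepS
  simp only [eq_iff_iff]
  exact (not_congr this).symm

end Summit.AtomisticToContinuum.Crystallization.Theorems.ChartedPlanarOrderDefectEventMeasurable
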